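import Summits.HodgeConjecture.HodgeConjecture.Theorems.Ring2WeilCoverageCMFieldNormResidueSymbolsDyadicCubicCarriers
import HarnessLib

/-!
# Ring 2 — Weil-family coverage, CM-field rows: THE DYADIC COLUMN of the `T`-labels for the three COMPOSITE sextic
  census carriers `ℚ(ζ₇)⁺(√−3)` (dyadic INERT), `ℚ(ζ₇)⁺(i)` and `ℚ(ζ₉)⁺(i)` (dyadic RAMIFIED ⇒ parity) — sub-cell (ix″),
  part 11 (WEIL-FAMILY-COVERAGE «## b03»)

research route conditional on HC_CM; not a corollary; Q11.4-sentence-2 already refuted in dim ≥ 3.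

Sequel of `Ring2WeilCoverageCMFieldNormResidueSymbolsDyadicCubicCarriers` (cubic toolkit; `ℚ(ζ₉)`, `ℚ(ζ₇)`).  The `g = 12`
tables of §b03.23/§b03.24 also run over the composite sextic CM fields `F(√−3)`, `F(i)` for `F = ℚ(ζ₇)⁺, ℚ(ζ₉)⁺`
(carriers of part X-AE/X-AF: `R₂₁ = S³ + 15S² + 54S + 27`, `R₂₈ = S³ + 5S² + 6S + 1`, `R₃₆ = S³ + 6S² + 9S + 1`;
`ℚ(ζ₉)⁺(√−3) = ℚ(ζ₉)` is part 10).  On Deligne's carriers the rows are labelled by `T(q) = badPlaces q θ`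
[cite: Deligne1982HodgeCycles, §4: display (1), Prop. 4.1, Cor. 4.2]; the dyadic entry is decided here:

* §23 `ℚ(ζ₇)⁺(√−3)`: `θ = ((θ+3)/(θ+6))²·(−3)` (dyadic normalisation, `ρ = −1`); `2` is inert in `F` (one witness:
  Bezout identities for `θ² − θ`, `θ⁴ − θ` against `R₂₁ ≡ S³ + S² + 1 (mod 2)`), `𝓞_F/v₂ = 𝔽₈` has no primitive cube
  root of unity (`1 = (1 − r² − r³ + r⁵ + r⁶)(r² − r + 1) − (r⁸ − r)`): INERT, **`v₂ ∈ T(q) ⟺ ord_{v₂} q` odd**, the dyadic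
  rows `[2w] ≠ [(−1)^k]` [cite: Omeara1963, §63C Example 63:16];
* §24 `ℚ(ζ₇)⁺(i)`, `ℚ(ζ₉)⁺(i)`: `E = F(√−1)` is ramified at the dyadic place (`−1` has quadratic defect `2𝔬` in the
  unramified cubic `F_{v₂}/ℚ₂`), so no normalisation exists; `v₂ = (2)` is proved unique (`cubic_dyadic_of_witness`) and
  **`v₂ ∈ T(q) ⟺` the number of non-dyadic places of `T(q)` is odd** [cite: Omeara1963, §71D Thm. 71:18].
With parts 6–10: the dyadic column is decided for twelve of the thirteen census carriers of «## b03» (all but the non-Galois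
sextic example `F₁₄₈(i)`: its cubic `F` has even discriminant `148`, `2` ramifies in `F`, and the one-witness toolkit does not apply).  No new definition, no named fact, no sorry; nothing about the
Hodge conjecture is asserted.
-/

noncomputable section

set_option linter.dupNamespace false

open Polynomial NumberField IsDedekindDomain

namespace Summit.HodgeConjecture.HodgeConjecture.Ring2.WeilCoverageCM

open Literature.AlgebraicGeometry.Deligne1982
open Literature.AlgebraicGeometry.HodgeTheory (splitDiscriminantClassCM)
open Literature.NumberTheory.QuadraticForms

/-! ### §23 `E = ℚ(ζ₇)⁺(√−3) ⊂ ℚ(ζ₂₁)`, `R = S³ + 15S² + 54S + 27`: the dyadic place of `F = ℚ(ζ₇)⁺` is INERT in `E`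
(`𝔽₈` has no primitive cube root of unity) — `v₂ ∈ T(q) ⟺ ord_{v₂} q` odd -/

section R21

variable {R : Polynomial ℤ} [Fact (Irreducible (cmPolyQ R))] [Fact (Irreducible (realPolyQ R))]

omit [Fact (Irreducible (cmPolyQ R))] in
/-- **Dyadic normalisation of the `ℚ(ζ₇)⁺(√−3)` carrier**: `θ = ((θ+3)/(θ+6))²·(1 + 4·(−1))` (from `θ·t² = −3`,
`t = −(θ+6)/(θ+3)`, part X-AF). [folklore] -/
theorem R21_root_eq_sq_mul_one_add_four_mul (hR : R = X ^ 3 + C 15 * X ^ 2 + C 54 * X + C 27) :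
    AdjoinRoot.root (realPolyQ R) =
      ((AdjoinRoot.root (realPolyQ R) + 3) / (AdjoinRoot.root (realPolyQ R) + 6)) ^ 2 *
        ((1 + 4 * (-1) : 𝓞 (realField R)) : realField R) := by
  have hrel := root_rel_cubic hR
  push_cast at hrel
  have h6 : AdjoinRoot.root (realPolyQ R) + 6 ≠ 0 := by
    intro h
    have : AdjoinRoot.root (realPolyQ R) = -6 := by linear_combination h
    rw [this] at hrel
    norm_num at hrel
  simp only [map_add, map_mul, map_one, map_ofNat, map_neg]
  field_simp
  linear_combination hrel

omit [Fact (Irreducible (cmPolyQ R))] in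
/-- `θ² − θ ∉ v₂` and `θ⁴ − θ ∉ v₂` (`R ≡ S³ + S² + 1 (mod 2)`, irreducible): the dyadic residue field of `ℚ(ζ₇)⁺` in this
presentation is `𝔽₈`. [folklore] -/
theorem R21_sq_sub_self_notMem_and (hR : R = X ^ 3 + C 15 * X ^ 2 + C 54 * X + C 27) {θₒ : 𝓞 (realField R)}
    (hθ : (θₒ : realField R) = AdjoinRoot.root (realPolyQ R)) (v : HeightOneSpectrum (𝓞 (realField R)))
    (h2 : (2 : 𝓞 (realField R)) ∈ v.asIdeal) : θₒ ^ 2 - θₒ ∉ v.asIdeal ∧ θₒ ^ 4 - θₒ ∉ v.asIdeal := by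
  have hrel : θₒ ^ 3 + 15 * θₒ ^ 2 + 54 * θₒ + 27 = 0 := by simpa using ringOfIntegers_root_rel_cubic hR hθ
  have h1 : (1 : 𝓞 (realField R)) ∉ v.asIdeal := fun h ↦ v.isPrime.ne_top ((Ideal.eq_top_iff_one _).2 h)
  constructor
  · intro h
    refine h1 ?_
    have key : (1 : 𝓞 (realField R)) = θₒ * (θₒ ^ 2 - θₒ) - (θₒ ^ 3 + 15 * θₒ ^ 2 + 54 * θₒ + 27) +
        2 * (14 + 27 * θₒ + 8 * θₒ ^ 2) := by ring
    rw [key, hrel, sub_zero]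
    exact v.asIdeal.add_mem (v.asIdeal.mul_mem_left _ h) (v.asIdeal.mul_mem_right _ h2)
  · intro h
    refine h1 ?_
    have key : (1 : 𝓞 (realField R)) = (1 + θₒ + θₒ ^ 2) * (θₒ ^ 4 - θₒ) -
        (-1627 + 157 * θₒ - 14 * θₒ ^ 2 + θₒ ^ 3) * (θₒ ^ 3 + 15 * θₒ ^ 2 + 54 * θₒ + 27) -
        2 * (21964 + 41809 * θₒ + 8152 * θₒ ^ 2) := by ring
    rw [key, hrel, mul_zero, sub_zero]
    exact v.asIdeal.sub_mem (v.asIdeal.mul_mem_left _ h) (v.asIdeal.mul_mem_right _ h2)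

omit [Fact (Irreducible (cmPolyQ R))] in
/-- **The dyadic place of `ℚ(ζ₇)⁺` (presentation `R₂₁`): `v₂ = (2)`, unique, `ord 2 = 1`, `y⁸ ≡ y`.** [folklore] -/
theorem R21_dyadic (hR : R = X ^ 3 + C 15 * X ^ 2 + C 54 * X + C 27) {θₒ : 𝓞 (realField R)}
    (hθ : (θₒ : realField R) = AdjoinRoot.root (realPolyQ R)) (v : HeightOneSpectrum (𝓞 (realField R)))
    (h2 : (2 : 𝓞 (realField R)) ∈ v.asIdeal) :
    v.asIdeal = Ideal.span {(2 : 𝓞 (realField R))} ∧ (∀ y : 𝓞 (realField R), y ^ 8 - y ∈ v.asIdeal) ∧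
      WithZero.log (v.valuation (realField R) (2 : realField R)) = -1 ∧
      ∀ v' : HeightOneSpectrum (𝓞 (realField R)), (2 : 𝓞 (realField R)) ∈ v'.asIdeal → v' = v := by
  have hF := finrank_realField_cubic hR
  have hx := fun w (hw : (2 : 𝓞 (realField R)) ∈ w.asIdeal) ↦ R21_sq_sub_self_notMem_and hR hθ w hw
  refine ⟨asIdeal_eq_span_two_of_dyadic_cubic hF v h2 (hx v h2).1 (hx v h2).2,
    pow_eight_sub_self_mem_of_dyadic hF v h2 (hx v h2).1 (hx v h2).2, ?_,
    fun v' h2' ↦ dyadic_unique_cubic hF v' v h2' h2 (hx v' h2').1 (hx v' h2').2 (hx v h2).1 (hx v h2).2⟩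
  rw [show (2 : realField R) = algebraMap (𝓞 (realField R)) (realField R) 2 by rw [map_ofNat],
    HeightOneSpectrum.valuation_of_algebraMap, intValuation_two_of_dyadic_cubic hF v h2 (hx v h2).1 (hx v h2).2,
    WithZero.log_exp]

omit [Fact (Irreducible (cmPolyQ R))] in
/-- **INERT**: `X² − X + 1` has no root modulo `v₂` — a root `r` would satisfy `r³ ≡ −1`, `r⁸ ≡ r² ≡ r − 1`, against
`r⁸ ≡ r` in `𝔽₈` (identity `1 = (1 − r² − r³ + r⁵ + r⁶)(r² − r + 1) − (r⁸ − r)`). [folklore] -/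
theorem R21_dyadic_inert (hR : R = X ^ 3 + C 15 * X ^ 2 + C 54 * X + C 27) {θₒ : 𝓞 (realField R)}
    (hθ : (θₒ : realField R) = AdjoinRoot.root (realPolyQ R)) (v : HeightOneSpectrum (𝓞 (realField R)))
    (h2 : (2 : 𝓞 (realField R)) ∈ v.asIdeal) :
    ∀ r : 𝓞 (realField R), r ^ 2 - r - (-1) ∉ v.asIdeal := by
  intro r hr
  have h8 := (R21_dyadic hR hθ v h2).2.1 r
  have key : (1 : 𝓞 (realField R)) = (1 - r ^ 2 - r ^ 3 + r ^ 5 + r ^ 6) * (r ^ 2 - r - (-1)) - (r ^ 8 - r) := by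
    ring
  have hmem : (1 : 𝓞 (realField R)) ∈ v.asIdeal := by
    rw [key]
    exact v.asIdeal.sub_mem (v.asIdeal.mul_mem_left _ hr) h8
  exact v.isPrime.ne_top ((Ideal.eq_top_iff_one _).2 hmem)

/-- **THE DYADIC COLUMN OF THE `ℚ(ζ₇)⁺(√−3)` TABLE: `v₂ ∈ T(q) ⟺ ord_{v₂} q` odd.**
[cite: Omeara1963, §63C Example 63:16] [cite: Deligne1982HodgeCycles, §4 (1)] -/
theorem R21_inl_mem_badPlaces_iff_odd_of_dyadic (hR : R = X ^ 3 + C 15 * X ^ 2 + C 54 * X + C 27)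
    {θₒ : 𝓞 (realField R)} (hθ : (θₒ : realField R) = AdjoinRoot.root (realPolyQ R))
    (v : HeightOneSpectrum (𝓞 (realField R))) (h2 : (2 : 𝓞 (realField R)) ∈ v.asIdeal) (q : (realField R)ˣ) :
    Sum.inl v ∈ badPlaces (q : realField R) (AdjoinRoot.root (realPolyQ R)) ↔
      Odd (WithZero.log (v.valuation (realField R) (q : realField R))) :=
  inl_mem_badPlaces_iff_odd_of_dyadic_inert (R21_root_eq_sq_mul_one_add_four_mul hR) v h2 (R21_dyadic_inert hR hθ v h2) q

/-- The dyadic rows of `ℚ(ζ₇)⁺(√−3)`: `[2w] ≠ [(−1)^k]` for every `v₂`-unit `w ∈ 𝓞_F` (§b03.24/X-AJ: `[n] = [1]` iff every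
prime `≡ 2 (mod 3)` — so `2` — divides `n` to an even power). [cite: Deligne1982HodgeCycles, §4 (1) and Cor. 4.2]
[cite: Omeara1963, §63C Example 63:16] -/
theorem R21_mk_two_mul_ne_splitDiscriminantClassCM (hR : R = X ^ 3 + C 15 * X ^ 2 + C 54 * X + C 27)
    {θₒ : 𝓞 (realField R)} (hθ : (θₒ : realField R) = AdjoinRoot.root (realPolyQ R))
    (v : HeightOneSpectrum (𝓞 (realField R))) (h2 : (2 : 𝓞 (realField R)) ∈ v.asIdeal) {w : 𝓞 (realField R)}
    (hw : w ∉ v.asIdeal) (q : (realField R)ˣ) (hq : (q : realField R) = 2 * (w : realField R)) (k : ℕ) :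
    (QuotientGroup.mk q : cmNormResidueGroup R) ≠ splitDiscriminantClassCM R k := by
  refine mk_ne_splitDiscriminantClassCM_of_odd_log_valuation_dyadic (R21_root_eq_sq_mul_one_add_four_mul hR) v h2
    (R21_dyadic_inert hR hθ v h2) ?_ k
  have h20 : v.valuation (realField R) (2 : realField R) ≠ 0 := (Valuation.ne_zero_iff _).2 two_ne_zero
  have hw0 : v.valuation (realField R) (w : realField R) ≠ 0 := by
    refine (Valuation.ne_zero_iff _).2 fun h ↦ hw ?_
    rw [show w = 0 from RingOfIntegers.coe_injective (by simpa using h)]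
    exact v.asIdeal.zero_mem
  have hw1 : WithZero.log (v.valuation (realField R) (w : realField R)) = 0 := by
    rw [show (w : realField R) = algebraMap (𝓞 (realField R)) (realField R) w from rfl,
      HeightOneSpectrum.valuation_of_algebraMap, HeightOneSpectrum.intValuation_eq_one_iff.2 hw, WithZero.log_one]
  rw [hq, map_mul, WithZero.log_mul h20 hw0, (R21_dyadic hR hθ v h2).2.2.1, hw1]
  decide

end R21

/-! ### §24 `E = ℚ(ζ₇)⁺(i)` (`R = S³ + 5S² + 6S + 1`) and `E = ℚ(ζ₉)⁺(i)` (`R = S³ + 6S² + 9S + 1`): `E = F(√−1)` is RAMIFIED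
at the unique dyadic place `v₂ = (2)` of `F` — membership = parity of the other memberships -/

section CompositeI

variable {R : Polynomial ℤ} [Fact (Irreducible (cmPolyQ R))] [Fact (Irreducible (realPolyQ R))]

omit [Fact (Irreducible (cmPolyQ R))] in
/-- `θ² − θ ∉ v₂` and `θ⁴ − θ ∉ v₂` for `R₂₈ = S³ + 5S² + 6S + 1` (`≡ S³ + S² + 1 (mod 2)`). [folklore] -/
theorem R28_sq_sub_self_notMem_and (hR : R = X ^ 3 + C 5 * X ^ 2 + C 6 * X + C 1) {θₒ : 𝓞 (realField R)}
    (hθ : (θₒ : realField R) = AdjoinRoot.root (realPolyQ R)) (v : HeightOneSpectrum (𝓞 (realField R)))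
    (h2 : (2 : 𝓞 (realField R)) ∈ v.asIdeal) : θₒ ^ 2 - θₒ ∉ v.asIdeal ∧ θₒ ^ 4 - θₒ ∉ v.asIdeal := by
  have hrel : θₒ ^ 3 + 5 * θₒ ^ 2 + 6 * θₒ + 1 = 0 := by simpa using ringOfIntegers_root_rel_cubic hR hθ
  have h1 : (1 : 𝓞 (realField R)) ∉ v.asIdeal := fun h ↦ v.isPrime.ne_top ((Ideal.eq_top_iff_one _).2 h)
  constructor
  · intro h
    refine h1 ?_
    have key : (1 : 𝓞 (realField R)) = θₒ * (θₒ ^ 2 - θₒ) - (θₒ ^ 3 + 5 * θₒ ^ 2 + 6 * θₒ + 1) +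
        2 * (1 + 3 * θₒ + 3 * θₒ ^ 2) := by ring
    rw [key, hrel, sub_zero]
    exact v.asIdeal.add_mem (v.asIdeal.mul_mem_left _ h) (v.asIdeal.mul_mem_right _ h2)
  · intro h
    refine h1 ?_
    have key : (1 : 𝓞 (realField R)) = (1 + θₒ + θₒ ^ 2) * (θₒ ^ 4 - θₒ) -
        (-53 + 15 * θₒ - 4 * θₒ ^ 2 + θₒ ^ 3) * (θₒ ^ 3 + 5 * θₒ ^ 2 + 6 * θₒ + 1) -
        2 * (26 + 151 * θₒ + 89 * θₒ ^ 2) := by ring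
    rw [key, hrel, mul_zero, sub_zero]
    exact v.asIdeal.sub_mem (v.asIdeal.mul_mem_left _ h) (v.asIdeal.mul_mem_right _ h2)

omit [Fact (Irreducible (cmPolyQ R))] in
/-- `θ² − θ ∉ v₂` and `θ⁴ − θ ∉ v₂` for `R₃₆ = S³ + 6S² + 9S + 1` (`≡ S³ + S + 1 (mod 2)`). [folklore] -/
theorem R36_sq_sub_self_notMem_and (hR : R = X ^ 3 + C 6 * X ^ 2 + C 9 * X + C 1) {θₒ : 𝓞 (realField R)}
    (hθ : (θₒ : realField R) = AdjoinRoot.root (realPolyQ R)) (v : HeightOneSpectrum (𝓞 (realField R)))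
    (h2 : (2 : 𝓞 (realField R)) ∈ v.asIdeal) : θₒ ^ 2 - θₒ ∉ v.asIdeal ∧ θₒ ^ 4 - θₒ ∉ v.asIdeal := by
  have hrel : θₒ ^ 3 + 6 * θₒ ^ 2 + 9 * θₒ + 1 = 0 := by simpa using ringOfIntegers_root_rel_cubic hR hθ
  have h1 : (1 : 𝓞 (realField R)) ∉ v.asIdeal := fun h ↦ v.isPrime.ne_top ((Ideal.eq_top_iff_one _).2 h)
  constructor
  · intro h
    refine h1 ?_
    have key : (1 : 𝓞 (realField R)) = (1 + θₒ) * (θₒ ^ 2 - θₒ) - (θₒ ^ 3 + 6 * θₒ ^ 2 + 9 * θₒ + 1) +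
        2 * (1 + 5 * θₒ + 3 * θₒ ^ 2) := by ring
    rw [key, hrel, sub_zero]
    exact v.asIdeal.add_mem (v.asIdeal.mul_mem_left _ h) (v.asIdeal.mul_mem_right _ h2)
  · intro h
    refine h1 ?_
    have key : (1 : 𝓞 (realField R)) = (1 + θₒ + θₒ ^ 2) * (θₒ ^ 4 - θₒ) -
        (-89 + 22 * θₒ - 5 * θₒ ^ 2 + θₒ ^ 3) * (θₒ ^ 3 + 6 * θₒ ^ 2 + 9 * θₒ + 1) -
        2 * (44 + 389 * θₒ + 170 * θₒ ^ 2) := by ring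
    rw [key, hrel, mul_zero, sub_zero]
    exact v.asIdeal.sub_mem (v.asIdeal.mul_mem_left _ h) (v.asIdeal.mul_mem_right _ h2)

omit [Fact (Irreducible (cmPolyQ R))] in
/-- **A cubic carrier with `2` inert (one witness `x`): `v₂ = (2)`, unique, `ord 2 = 1`** — packaged. [folklore] -/
theorem cubic_dyadic_of_witness {a b c : ℤ} (hR : R = X ^ 3 + C a * X ^ 2 + C b * X + C c) {x : 𝓞 (realField R)}
    (hx : ∀ w : HeightOneSpectrum (𝓞 (realField R)), (2 : 𝓞 (realField R)) ∈ w.asIdeal →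
      x ^ 2 - x ∉ w.asIdeal ∧ x ^ 4 - x ∉ w.asIdeal)
    (v : HeightOneSpectrum (𝓞 (realField R))) (h2 : (2 : 𝓞 (realField R)) ∈ v.asIdeal) :
    v.asIdeal = Ideal.span {(2 : 𝓞 (realField R))} ∧
      WithZero.log (v.valuation (realField R) (2 : realField R)) = -1 ∧
      ∀ v' : HeightOneSpectrum (𝓞 (realField R)), (2 : 𝓞 (realField R)) ∈ v'.asIdeal → v' = v := by
  have hF := finrank_realField_cubic hR
  refine ⟨asIdeal_eq_span_two_of_dyadic_cubic hF v h2 (hx v h2).1 (hx v h2).2, ?_,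
    fun v' h2' ↦ dyadic_unique_cubic hF v' v h2' h2 (hx v' h2').1 (hx v' h2').2 (hx v h2).1 (hx v h2).2⟩
  rw [show (2 : realField R) = algebraMap (𝓞 (realField R)) (realField R) 2 by rw [map_ofNat],
    HeightOneSpectrum.valuation_of_algebraMap, intValuation_two_of_dyadic_cubic hF v h2 (hx v h2).1 (hx v h2).2,
    WithZero.log_exp]

/-- **THE DYADIC COLUMN for `ℚ(ζ₇)⁺(i)`** (`E = F(√−1)` ramified at `v₂ = (2)`): `v₂ ∈ T(q) ⟺` the number of non-dyadic
places in `T(q)` is odd. [cite: Omeara1963, §71D Thm. 71:18] [cite: Deligne1982HodgeCycles, §4 (1)] -/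
theorem R28_inl_mem_badPlaces_dyadic_iff (hR : R = X ^ 3 + C 5 * X ^ 2 + C 6 * X + C 1) {θₒ : 𝓞 (realField R)}
    (hθ : (θₒ : realField R) = AdjoinRoot.root (realPolyQ R)) (v : HeightOneSpectrum (𝓞 (realField R)))
    (h2 : (2 : 𝓞 (realField R)) ∈ v.asIdeal) (q : (realField R)ˣ) :
    Sum.inl v ∈ badPlaces (q : realField R) (AdjoinRoot.root (realPolyQ R)) ↔
      Odd {p ∈ badPlaces (q : realField R) (AdjoinRoot.root (realPolyQ R)) |
        ∀ v' : HeightOneSpectrum (𝓞 (realField R)), p = Sum.inl v' → (2 : 𝓞 (realField R)) ∉ v'.asIdeal}.ncard :=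
  inl_mem_badPlaces_iff_odd_ncard_of_unique_dyadic q v h2
    (cubic_dyadic_of_witness hR (fun w hw ↦ R28_sq_sub_self_notMem_and hR hθ w hw) v h2).2.2

/-- **THE DYADIC COLUMN for `ℚ(ζ₉)⁺(i)`** (`E = F(√−1)` ramified at `v₂ = (2)`): `v₂ ∈ T(q) ⟺` the number of non-dyadic
places in `T(q)` is odd. [cite: Omeara1963, §71D Thm. 71:18] [cite: Deligne1982HodgeCycles, §4 (1)] -/
theorem R36_inl_mem_badPlaces_dyadic_iff (hR : R = X ^ 3 + C 6 * X ^ 2 + C 9 * X + C 1) {θₒ : 𝓞 (realField R)}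
    (hθ : (θₒ : realField R) = AdjoinRoot.root (realPolyQ R)) (v : HeightOneSpectrum (𝓞 (realField R)))
    (h2 : (2 : 𝓞 (realField R)) ∈ v.asIdeal) (q : (realField R)ˣ) :
    Sum.inl v ∈ badPlaces (q : realField R) (AdjoinRoot.root (realPolyQ R)) ↔
      Odd {p ∈ badPlaces (q : realField R) (AdjoinRoot.root (realPolyQ R)) |
        ∀ v' : HeightOneSpectrum (𝓞 (realField R)), p = Sum.inl v' → (2 : 𝓞 (realField R)) ∉ v'.asIdeal}.ncard :=
  inl_mem_badPlaces_iff_odd_ncard_of_unique_dyadic q v h2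
    (cubic_dyadic_of_witness hR (fun w hw ↦ R36_sq_sub_self_notMem_and hR hθ w hw) v h2).2.2

end CompositeI

end Summit.HodgeConjecture.HodgeConjecture.Ring2.WeilCoverageCM

end
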